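import Mathlib
import Summits.ResolutionOfSingularities.ResolutionOfSingularities.Theorems.FrobeniusLadderFInjectiveMacaulayficationProp44Assembly
import HarnessLib

/-!
# Route `RadicialJung`, crux `CleanModels` (stmt-ResolutionOfSingularities-15917), line `Sketch` rev 35, stub 6 `stub_cleanProp44` (X44c),
# `τ = 1` residual: THE LANDED T1 RE-BASED — an infinite `τ = 1` near chain has INFINITELY MANY ESCAPE LEVELS

Seat decomp-res-hand-2 g13 (structural hand: «reduce to the most general landed lemma in the dossier, then specialise»).  The most general landed
termination theorem of the dossier is the tree's ✓ `CP2008Prop44.stub_T1` (`…FrobeniusLadderFInjectiveMacaulayficationProp44Assembly.lean`, over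
✓ `T1_of_N2full'` and the ring CONTRACT v3′ ✓ `Literature.….false_of_fullChain_tau_one'` = CJS 2020 Thm. 13.7): there is NO infinite chain of
closed `τ = 1` near points `x₀ ← x₁ ← ⋯` (embedding dimension `3`, `ord = μ` kept, G-ring stalks) under blowing ups of regular irreducible centres
`Y_n ⊆ Σ_μ(J_n)` through `x_n`, PROVIDED at every level the centre is COINCIDENT: every generization of `x_n` of order `μ` lies in `Y_n`
(binder `hcoinc` — locally at `x_n`, `Y_n` is all of `Σ_μ`).

The clean strategy of memo `Cruxes/CleanModels/Lines/Sketch-memo-4e-cleanPermissible.md` §2.2–2.6 violates `hcoinc` exactly at its INSERTION levels: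
a point `x_n` is blown up although a `Σ_μ`-curve passes through it, because that curve is not clean-permissible there (L7b insertions at
`W`-tangency points; births (B2)/(B4)) or is scheduled later by the `o`-priority.  Call a level `n` an ESCAPE LEVEL of the chain if some
generization `z ⤳ x_n` with `ord_z J_n = μ` lies outside `Y_n`.  This file proves, from the landed theorem alone:

* `tauOne_chain_false_of_eventually_coincident` — **T1 RE-BASED**: the binders of ✓ `stub_T1` with `hcoinc` assumed only from some level `N` on
  still give `False` (shift the chain by `N`).
* `tauOne_chain_frequently_escape` — **contrapositive: WITHOUT `hcoinc`, every infinite `τ = 1` near chain (other binders verbatim) has escape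
  levels beyond every `N`**; `tauOne_chain_escape_infinite` — the set of escape levels is infinite.

Consequence for the census of stub 6 (✓ `cleanProp44_of_tauOneResidual`: X44c ⟸ clean Phase II + clean `τ = 1` point slice + clean curve slice):
along any infinite run of the clean `τ = 1` game the chain point passes through INFINITELY MANY insertion levels; so the termination content of the
clean `τ = 1` residual beyond the landed T1 is exactly «no chain meets infinitely many insertion levels» — the births statement (B′) of the memo
(hand: §2.5–2.6 + hand-2 g12 §4 (c); kernel algebra ✓ `…Birth*.lean`), and nothing at the coincident levels.

Honest framing: OURS; two corollaries of a landed theorem (re-basing + contraposition); nothing here proves (B′), the hypotheses of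
✓ `cleanProp44_of_tauOneResidual`, X44c, any case of `CleanModels`, or resolution of singularities in characteristic `p`.
[cite: CossartPiltant2008, Prop. 4.4 (proof, p. 11), Lemma 4.5] [cite: CossartJannsenSaito2020, Thm. 13.7]
-/

set_option linter.dupNamespace false -- mandated namespace of this single-conjunct summit

noncomputable section

open CategoryTheory AlgebraicGeometry TopologicalSpace IsLocalRing
open Literature.AlgebraicGeometry.Resolution Scheme.IdealSheafData
open Summit.ResolutionOfSingularities.ResolutionOfSingularities.Theorems.CP2008Prop44

namespace Summit.ResolutionOfSingularities.ResolutionOfSingularities.Theorems.RadicialJung.CleanModels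

universe u

/-- **T1 RE-BASED at a level `N`.**  The binders of ✓ `CP2008Prop44.stub_T1` verbatim, except that the coincidence of the centre with `Σ_μ` at the
chain point (`hcoinc`) is only assumed for the levels `n ≥ N`: still `False` (apply `stub_T1` to the chain shifted by `N`).
[cite: CossartPiltant2008, Prop. 4.4 (proof, p. 11)] [cite: CossartJannsenSaito2020, Thm. 13.7] -/
theorem tauOne_chain_false_of_eventually_coincident (Xs : ℕ → Scheme.{u})
    (hN : ∀ n, IsLocallyNoetherian (Xs n)) (hXreg : ∀ n, Scheme.IsRegular (Xs n))
    (π : ∀ n, Xs (n + 1) ⟶ Xs n) (Y : ∀ n, Closeds (Xs n)) (y : ∀ n, Xs (n + 1))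
    (J : ∀ n, (Xs n).IdealSheafData) {μ : ℕ} (hμ : 1 ≤ μ)
    (hy : ∀ n, π (n + 1) (y (n + 1)) = y n)
    (hmem : ∀ n, π n (y n) ∈ (Y n : Set (Xs n)))
    (hcl : ∀ n, IsClosed ({π n (y n)} : Set (Xs n)))
    (hYirr : ∀ n, IsIrreducible ((Y n : Closeds (Xs n)) : Set (Xs n)))
    (hYreg : ∀ n, Scheme.IsRegular (vanishingIdeal (Y n)).subscheme)
    (hYord : ∀ n, ∀ z ∈ (Y n : Set (Xs n)), idealOrder (J n) z = μ)
    (hπ : ∀ n, IsBlowup (π n) (vanishingIdeal (Y n)))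
    (hJ : ∀ n, J (n + 1) = controlledTransform (π n) (vanishingIdeal (Y n)) (J n) μ)
    (hbd : ∀ n (z : Xs n), idealOrder (J n) z ≤ μ)
    (hcodim : ∀ n, ∀ z ∈ (J n).support, 1 < Order.coheight z)
    (hd : ∀ n, (maximalIdeal ((Xs n).presheaf.stalk (π n (y n)))).spanFinrank = 3)
    (hnear : ∀ n, IsNear (π n) (vanishingIdeal (Y n)) (J n) μ (y n))
    (hτ : ∀ n, @stalkTau (Xs n) (J n) (π n (y n)) (hXreg n (π n (y n))) μ = 1)
    (hG : ∀ n, IsGRing ((Xs n).presheaf.stalk (π n (y n))))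
    (N : ℕ) (hcoinc : ∀ n, N ≤ n → ∀ z : Xs n, z ⤳ π n (y n) → idealOrder (J n) z = μ → z ∈ (Y n : Set (Xs n))) :
    False :=
  stub_T1 (fun k => Xs (N + k)) (fun k => hN (N + k)) (fun k => hXreg (N + k))
    (fun k => π (N + k)) (fun k => Y (N + k)) (fun k => y (N + k)) (fun k => J (N + k)) hμ
    (fun k => hy (N + k)) (fun k => hmem (N + k)) (fun k => hcl (N + k)) (fun k => hYirr (N + k))
    (fun k => hYreg (N + k)) (fun k => hYord (N + k)) (fun k => hπ (N + k)) (fun k => hJ (N + k))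
    (fun k => hbd (N + k)) (fun k => hcodim (N + k)) (fun k => hd (N + k)) (fun k => hnear (N + k))
    (fun k => hτ (N + k)) (fun k => hG (N + k)) (fun k => hcoinc (N + k) (Nat.le_add_right N k))

/-- **An infinite `τ = 1` near chain has ESCAPE LEVELS beyond every `N`.**  The binders of ✓ `CP2008Prop44.stub_T1` WITHOUT `hcoinc`: then for every
`N` there is a level `n ≥ N` and a generization `z ⤳ x_n` (`x_n = π_n(y_n)` the chain point) with `ord_z J_n = μ` and `z ∉ Y_n` — a branch of
`Σ_μ(J_n)` through the chain point escaping the centre.  In the clean strategy these are the insertion levels (L7b / births).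
[cite: CossartPiltant2008, Prop. 4.4 (proof, p. 11)] [cite: CossartJannsenSaito2020, Thm. 13.7] -/
theorem tauOne_chain_frequently_escape (Xs : ℕ → Scheme.{u})
    (hN : ∀ n, IsLocallyNoetherian (Xs n)) (hXreg : ∀ n, Scheme.IsRegular (Xs n))
    (π : ∀ n, Xs (n + 1) ⟶ Xs n) (Y : ∀ n, Closeds (Xs n)) (y : ∀ n, Xs (n + 1))
    (J : ∀ n, (Xs n).IdealSheafData) {μ : ℕ} (hμ : 1 ≤ μ)
    (hy : ∀ n, π (n + 1) (y (n + 1)) = y n)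
    (hmem : ∀ n, π n (y n) ∈ (Y n : Set (Xs n)))
    (hcl : ∀ n, IsClosed ({π n (y n)} : Set (Xs n)))
    (hYirr : ∀ n, IsIrreducible ((Y n : Closeds (Xs n)) : Set (Xs n)))
    (hYreg : ∀ n, Scheme.IsRegular (vanishingIdeal (Y n)).subscheme)
    (hYord : ∀ n, ∀ z ∈ (Y n : Set (Xs n)), idealOrder (J n) z = μ)
    (hπ : ∀ n, IsBlowup (π n) (vanishingIdeal (Y n)))
    (hJ : ∀ n, J (n + 1) = controlledTransform (π n) (vanishingIdeal (Y n)) (J n) μ)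
    (hbd : ∀ n (z : Xs n), idealOrder (J n) z ≤ μ)
    (hcodim : ∀ n, ∀ z ∈ (J n).support, 1 < Order.coheight z)
    (hd : ∀ n, (maximalIdeal ((Xs n).presheaf.stalk (π n (y n)))).spanFinrank = 3)
    (hnear : ∀ n, IsNear (π n) (vanishingIdeal (Y n)) (J n) μ (y n))
    (hτ : ∀ n, @stalkTau (Xs n) (J n) (π n (y n)) (hXreg n (π n (y n))) μ = 1)
    (hG : ∀ n, IsGRing ((Xs n).presheaf.stalk (π n (y n)))) (N : ℕ) :
    ∃ n, N ≤ n ∧ ∃ z : Xs n, z ⤳ π n (y n) ∧ idealOrder (J n) z = μ ∧ z ∉ (Y n : Set (Xs n)) := by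
  by_contra h
  push Not at h
  exact tauOne_chain_false_of_eventually_coincident Xs hN hXreg π Y y J hμ hy hmem hcl hYirr hYreg hYord hπ hJ hbd
    hcodim hd hnear hτ hG N (fun n hn z hz hord => h n hn z hz hord)

/-- **The set of escape levels of an infinite `τ = 1` near chain is infinite** (binders of ✓ `CP2008Prop44.stub_T1` without `hcoinc`).
[cite: CossartPiltant2008, Prop. 4.4 (proof, p. 11)] [cite: CossartJannsenSaito2020, Thm. 13.7] -/
theorem tauOne_chain_escape_infinite (Xs : ℕ → Scheme.{u})
    (hN : ∀ n, IsLocallyNoetherian (Xs n)) (hXreg : ∀ n, Scheme.IsRegular (Xs n))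
    (π : ∀ n, Xs (n + 1) ⟶ Xs n) (Y : ∀ n, Closeds (Xs n)) (y : ∀ n, Xs (n + 1))
    (J : ∀ n, (Xs n).IdealSheafData) {μ : ℕ} (hμ : 1 ≤ μ)
    (hy : ∀ n, π (n + 1) (y (n + 1)) = y n)
    (hmem : ∀ n, π n (y n) ∈ (Y n : Set (Xs n)))
    (hcl : ∀ n, IsClosed ({π n (y n)} : Set (Xs n)))
    (hYirr : ∀ n, IsIrreducible ((Y n : Closeds (Xs n)) : Set (Xs n)))
    (hYreg : ∀ n, Scheme.IsRegular (vanishingIdeal (Y n)).subscheme)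
    (hYord : ∀ n, ∀ z ∈ (Y n : Set (Xs n)), idealOrder (J n) z = μ)
    (hπ : ∀ n, IsBlowup (π n) (vanishingIdeal (Y n)))
    (hJ : ∀ n, J (n + 1) = controlledTransform (π n) (vanishingIdeal (Y n)) (J n) μ)
    (hbd : ∀ n (z : Xs n), idealOrder (J n) z ≤ μ)
    (hcodim : ∀ n, ∀ z ∈ (J n).support, 1 < Order.coheight z)
    (hd : ∀ n, (maximalIdeal ((Xs n).presheaf.stalk (π n (y n)))).spanFinrank = 3)
    (hnear : ∀ n, IsNear (π n) (vanishingIdeal (Y n)) (J n) μ (y n))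
    (hτ : ∀ n, @stalkTau (Xs n) (J n) (π n (y n)) (hXreg n (π n (y n))) μ = 1)
    (hG : ∀ n, IsGRing ((Xs n).presheaf.stalk (π n (y n)))) :
    {n : ℕ | ∃ z : Xs n, z ⤳ π n (y n) ∧ idealOrder (J n) z = μ ∧ z ∉ (Y n : Set (Xs n))}.Infinite := by
  refine Nat.frequently_atTop_iff_infinite.mp ?_
  rw [Filter.frequently_atTop]
  intro N
  obtain ⟨n, hn, hz⟩ := tauOne_chain_frequently_escape Xs hN hXreg π Y y J hμ hy hmem hcl hYirr hYreg hYord hπ hJ hbd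
    hcodim hd hnear hτ hG N
  exact ⟨n, hn, hz⟩

end Summit.ResolutionOfSingularities.ResolutionOfSingularities.Theorems.RadicialJung.CleanModels

end
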